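import Summits.QuantumFields.YangMills.Theorems.UnitScaleTiltProp7TrueLinSourcedDefectL1
import Summits.QuantumFields.YangMills.Theorems.UnitScaleTiltProp7FibreTrueLinDefect
import HarnessLib

/-!
# Route `UnitScaleTilt`, crux K1 «MinimiserStabilityRegPr» (stmt-QuantumFields-19200), route-R [RP] curved, row (n3) N3b, file 2a —
# ON THE NONLINEAR (0.4)-FIBRE `W̄^{(k)} = Ū₀^{(k)}` THE TRUE LINEARISED ITERATE OF ANY INITIAL FIELD `X` IS CONTROLLED IN `ℓ¹`, k-UNIFORMLY, BY
# `‖WU₀* − 1 − X‖_{ℓ¹}` AND THE ONE-STEP TRUE-LINEARISATION REMAINDERS OF THE LEVEL RATIOS: `Σ_c‖Q^{(k)}X(c)‖ ≤ (1 + 4d(d+2)L)·E_k·(‖Y − X‖_{ℓ¹} + 260·Σ_{j<k}Σ_c m_j(c)²)`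

Cell `ym3-torus`, D-0154 (3c) extra-width seat `ym-routeR-w6` (gen 3); the `ℓ¹` TWIN of ★routeR-w3's ✓ `…Prop7FibreTrueLinDefect` (file B, `ℓ²`), on top of the `ℓ¹` transport
engine ✓∕⧗ `…Prop7TrueLinSourcedDefectL1` (files 1a∕1b of this seat).  THEOREMS ONLY (0 `def`, 0 `sorry`); `--supports stmt-QuantumFields-19200`, count-neutral.  YM₃ on T³ is a
ladder rung (R3), not the Clay problem; nothing here claims the stub, the crux, d = 4 or the mass gap.

THE POINT.  The growth-side door in multiplier currency (★p1 g13's ⧗ `…Prop7LocMinOfMultiplierRows`, ★w4-19200 g4's ✓ `…Prop7LocMinOfJointRow`) reads the `ℓ¹` size of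
`Q^{(K−n)}_W(iD)` at chart points `W′ = emb15 W (expHermField D)` ON the fibre.  With `Y_j := pertVar Ū₀^{(j)} W̄^{(j)}` the family `D′_j := Y_j − Q^{(j)}X` (ANY initial
field `X`, e.g. `X = I•D`) is SOURCED by the one-step remainders `R_j = Y_{j+1} − T_jY_j` (✓ A1 `sub_sourced`), starts at `D′_0 = Y − X` (`= e^{iD}W… − 1 − iD`, second order
for a chart point), and on the fibre `Y_k = 0` gives `Q^{(k)}X = −D′_k`; file 1b's ★★ `sum_norm_sourced_le` ∕ `…_uniform` then bound `‖Q^{(k)}X‖_{ℓ¹}` by the `ℓ¹` sizes of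
`Y − X` and of the remainders, which ★p1 g4's one-step theorem (✓ `Prop7HolRatioPerStep.norm_avgFun_ratio_sub_one_sub_trueLin_le`: `‖R_j(c)‖ ≤ 260·m_j(c)²`) turns into
DISPLAYED walk masses `m_j(c)` of the level ratios (§1; N3a ✓ `…Prop7FibreRemainderL1Level` reads them in mass currency `234000·L⁵·Σ_b‖Y_j b‖²` at d = 3).

WHAT IS PROVED (ns `…Theorems.Prop7FibreTrueLinDefectL1`; `SU(N)`, any `P`, `k ≤ m + K`).
* §1 `sum_norm_oneStep_remainder_le` — `Σ_c‖Y_{j+1}(c) − T_jY_j(c)‖ ≤ 260·Σ_c m_j(c)²`.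
* §2 ★★★ `sum_norm_trueLinIter_le_of_iter_eq` — on the fibre, for ANY `X`: `Σ_c‖Q k X c‖ ≤ E_k·(ρ₁ᵏg₀ + S_k) + 2d·Σ_{j<k}(d+2)L·E_j·(ρ₁ʲg₀ + S_j)`, `g₀ = Σ_b‖pertVar U₀ W b − X b‖`,
  `S_j = Σ_{i<j}ρ₁^{j−1−i}·260·Σ_c m_i(c)²`, `ρ₁ = (L^d)⁻¹L`, `E_j = exp((κ₁∕ρ₁)Σ_{i<j}a_i)`, `κ₁ = 159(d+2)L·2d`;
  ★★★ `sum_norm_trueLinIter_le_of_iter_eq_uniform` (`2 ≤ d`) — `Σ_c‖Q k X c‖ ≤ (1 + 4d(d+2)L)·E_k·(g₀ + Σ_{j<k} 260·Σ_c m_j(c)²)`.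
HONEST SCOPE.  Bookkeeping over files 1a∕1b, A1 and ★p1's one-step theorem; the walk masses stay displayed; this is the ABSOLUTE `ℓ¹` currency — the (M,K)-joint gain `ℓ⁻¹`
of the door's third row is NOT here (it lives in the cancellation between levels; LEAD ★p1 g13's comb-strip brick ∕ the exponential re-centring).  Nothing of
[Balaban1985Averaging] is asserted beyond the tree.

References: T. Bałaban, CMP 98 (1985) 17–51 [Balaban1985Averaging] (Prop. 3 (122)–(126) p.36); CMP 95 (1984) 17–40 [Balaban1984PropagatorsI] ((1.18)–(1.20) pp.19–20);
CMP 102 (1985) 277–309 [Balaban1985Variational] ((15) p.280, Prop. 7 p.299); CMP 109 (1987) 249–301 [Balaban1987RG1] ((0.4) p.253).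
-/

set_option autoImplicit false

noncomputable section

open scoped BigOperators Matrix.Norms.L2Operator

namespace Summit.QuantumFields.YangMills.Theorems.Prop7FibreTrueLinDefectL1

open Literature.MathematicalPhysics.QuantumFieldTheory.Balaban1983to89
open Finset T4Continuum BlockAveraging AveragingRT ExpMeanLog BlockAveragingEMLLinearised BlockAveragingEMLLinearisedBackground BlockAveragingEMLProp2
open Summit.QuantumFields.YangMills.Theorems.Prop7HolRatioPerStep (norm_avgFun_ratio_sub_one_sub_trueLin_le)
open Summit.QuantumFields.YangMills.Theorems.Prop7TrueLinSourcedStructure (exists_sourced_reduced_family sub_sourced)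
open Summit.QuantumFields.YangMills.Theorems.Prop7TrueLinSourcedDefectL1 (sum_norm_sourced_le)
open Summit.QuantumFields.YangMills.Theorems.Prop7TrueLinSourcedDefectL1Rows (geom_weights_uniform)
open Summit.QuantumFields.YangMills.Theorems.Prop7CurvedLandauRowA (exists_coarseGauge_family)
open Summit.QuantumFields.YangMills.Theorems.Prop7FibreTrueLinDefect (pertVar_self)

variable {P : Params} {N : ℕ} [NeZero N]

/-! ## §1 The one-step remainders in `ℓ¹` -/

/-- **THE ONE-STEP REMAINDERS OF THE LEVEL RATIOS IN `ℓ¹`** (★p1 g4's true linearisation, summed): at level `j` of the towers of `U₀` and `W`, if the ratio field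
`Y_j = pertVar Ū₀^{(j)} W̄^{(j)}` has walk masses `≤ m(c) ≤ 1/72` along the (0.4) walks at every `(j+1)`-bond `c`, and the background's loop variables are within
`α ≤ 1/24` of `1` with `3m(c) + α < δ_N`, then `Σ_c‖Y_{j+1}(c) − T_j[Y_j](c)‖ ≤ 260·Σ_c m(c)²`. [cite: Balaban1985Averaging, Prop. 3 (122)-(124) p.36] -/
theorem sum_norm_oneStep_remainder_le (U₀ W : GaugeField P 0 (Matrix.specialUnitaryGroup (Fin N) ℂ)) (j : ℕ) (m : PBond P (j + 1) → ℝ) {α : ℝ}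
    (hmL : ∀ (c : PBond P (j + 1)) (i : Idx P), ((walk (emb c.src) (loopWord P.L c.dir (off i.1) i.2.1 i.2.2)).map fun s => ‖pertVar (Averaging.iter (fun i => blockAvg (P := P) (j := i) (expMeanLogSU (n := Fin N))) j U₀) (Averaging.iter (fun i => blockAvg (P := P) (j := i) (expMeanLogSU (n := Fin N))) j W) s.bond‖).sum ≤ m c)
    (hmS : ∀ c : PBond P (j + 1), ((walk (emb c.src) (List.replicate P.L (c.dir, true))).map fun s => ‖pertVar (Averaging.iter (fun i => blockAvg (P := P) (j := i) (expMeanLogSU (n := Fin N))) j U₀) (Averaging.iter (fun i => blockAvg (P := P) (j := i) (expMeanLogSU (n := Fin N))) j W) s.bond‖).sum ≤ m c)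
    (hm72 : ∀ c : PBond P (j + 1), 72 * m c ≤ 1) (hα : ∀ (c : PBond P (j + 1)) (i : Idx P), dist1 (loopHol (Averaging.iter (fun i => blockAvg (P := P) (j := i) (expMeanLogSU (n := Fin N))) j U₀) c i) ≤ α) (hα24 : α ≤ 1 / 24)
    (hN : ∀ c : PBond P (j + 1), 3 * m c + α < deltaSU (Fin N)) :
    ∑ c : PBond P (j + 1), ‖((pertVar (Averaging.iter (fun i => blockAvg (P := P) (j := i) (expMeanLogSU (n := Fin N))) (j + 1) U₀) (Averaging.iter (fun i => blockAvg (P := P) (j := i) (expMeanLogSU (n := Fin N))) (j + 1) W)) c - (fderiv ℂ (eml : (Idx P → Matrix (Fin N) (Fin N) ℂ) → Matrix (Fin N) (Fin N) ℂ)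
            (fun i => ((loopHol (Averaging.iter (fun i => blockAvg (P := P) (j := i) (expMeanLogSU (n := Fin N))) j U₀) c i : Matrix.specialUnitaryGroup (Fin N) ℂ) : Matrix (Fin N) (Fin N) ℂ))
            (fun i => covWalkSum (Averaging.iter (fun i => blockAvg (P := P) (j := i) (expMeanLogSU (n := Fin N))) j U₀) (pertVar (Averaging.iter (fun i => blockAvg (P := P) (j := i) (expMeanLogSU (n := Fin N))) j U₀) (Averaging.iter (fun i => blockAvg (P := P) (j := i) (expMeanLogSU (n := Fin N))) j W)) (walk (emb c.src) (loopWord P.L c.dir (off i.1) i.2.1 i.2.2))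
              * ((loopHol (Averaging.iter (fun i => blockAvg (P := P) (j := i) (expMeanLogSU (n := Fin N))) j U₀) c i : Matrix.specialUnitaryGroup (Fin N) ℂ) : Matrix (Fin N) (Fin N) ℂ))
            * star ((corr (expMeanLogSU (n := Fin N)) (Averaging.iter (fun i => blockAvg (P := P) (j := i) (expMeanLogSU (n := Fin N))) j U₀) c : Matrix.specialUnitaryGroup (Fin N) ℂ) : Matrix (Fin N) (Fin N) ℂ)
          + ((corr (expMeanLogSU (n := Fin N)) (Averaging.iter (fun i => blockAvg (P := P) (j := i) (expMeanLogSU (n := Fin N))) j U₀) c : Matrix.specialUnitaryGroup (Fin N) ℂ) : Matrix (Fin N) (Fin N) ℂ)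
            * covWalkSum (Averaging.iter (fun i => blockAvg (P := P) (j := i) (expMeanLogSU (n := Fin N))) j U₀) (pertVar (Averaging.iter (fun i => blockAvg (P := P) (j := i) (expMeanLogSU (n := Fin N))) j U₀) (Averaging.iter (fun i => blockAvg (P := P) (j := i) (expMeanLogSU (n := Fin N))) j W)) (walk (emb c.src) (List.replicate P.L (c.dir, true)))
            * star ((corr (expMeanLogSU (n := Fin N)) (Averaging.iter (fun i => blockAvg (P := P) (j := i) (expMeanLogSU (n := Fin N))) j U₀) c : Matrix.specialUnitaryGroup (Fin N) ℂ) : Matrix (Fin N) (Fin N) ℂ)))‖ ≤ 260 * ∑ c : PBond P (j + 1), m c ^ 2 := by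
  have hpt : ∀ c : PBond P (j + 1), ‖((pertVar (Averaging.iter (fun i => blockAvg (P := P) (j := i) (expMeanLogSU (n := Fin N))) (j + 1) U₀) (Averaging.iter (fun i => blockAvg (P := P) (j := i) (expMeanLogSU (n := Fin N))) (j + 1) W)) c - (fderiv ℂ (eml : (Idx P → Matrix (Fin N) (Fin N) ℂ) → Matrix (Fin N) (Fin N) ℂ)
            (fun i => ((loopHol (Averaging.iter (fun i => blockAvg (P := P) (j := i) (expMeanLogSU (n := Fin N))) j U₀) c i : Matrix.specialUnitaryGroup (Fin N) ℂ) : Matrix (Fin N) (Fin N) ℂ))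
            (fun i => covWalkSum (Averaging.iter (fun i => blockAvg (P := P) (j := i) (expMeanLogSU (n := Fin N))) j U₀) (pertVar (Averaging.iter (fun i => blockAvg (P := P) (j := i) (expMeanLogSU (n := Fin N))) j U₀) (Averaging.iter (fun i => blockAvg (P := P) (j := i) (expMeanLogSU (n := Fin N))) j W)) (walk (emb c.src) (loopWord P.L c.dir (off i.1) i.2.1 i.2.2))
              * ((loopHol (Averaging.iter (fun i => blockAvg (P := P) (j := i) (expMeanLogSU (n := Fin N))) j U₀) c i : Matrix.specialUnitaryGroup (Fin N) ℂ) : Matrix (Fin N) (Fin N) ℂ))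
            * star ((corr (expMeanLogSU (n := Fin N)) (Averaging.iter (fun i => blockAvg (P := P) (j := i) (expMeanLogSU (n := Fin N))) j U₀) c : Matrix.specialUnitaryGroup (Fin N) ℂ) : Matrix (Fin N) (Fin N) ℂ)
          + ((corr (expMeanLogSU (n := Fin N)) (Averaging.iter (fun i => blockAvg (P := P) (j := i) (expMeanLogSU (n := Fin N))) j U₀) c : Matrix.specialUnitaryGroup (Fin N) ℂ) : Matrix (Fin N) (Fin N) ℂ)
            * covWalkSum (Averaging.iter (fun i => blockAvg (P := P) (j := i) (expMeanLogSU (n := Fin N))) j U₀) (pertVar (Averaging.iter (fun i => blockAvg (P := P) (j := i) (expMeanLogSU (n := Fin N))) j U₀) (Averaging.iter (fun i => blockAvg (P := P) (j := i) (expMeanLogSU (n := Fin N))) j W)) (walk (emb c.src) (List.replicate P.L (c.dir, true)))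
            * star ((corr (expMeanLogSU (n := Fin N)) (Averaging.iter (fun i => blockAvg (P := P) (j := i) (expMeanLogSU (n := Fin N))) j U₀) c : Matrix.specialUnitaryGroup (Fin N) ℂ) : Matrix (Fin N) (Fin N) ℂ)))‖ ≤ 260 * m c ^ 2 := by
    intro c
    have h := norm_avgFun_ratio_sub_one_sub_trueLin_le (Averaging.iter (fun i => blockAvg (P := P) (j := i) (expMeanLogSU (n := Fin N))) j U₀) (Averaging.iter (fun i => blockAvg (P := P) (j := i) (expMeanLogSU (n := Fin N))) j W) c (hmL c) (hmS c) (hm72 c) (hα c) hα24 (hN c)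
    rw [pertVar_eq]
    exact h
  calc _ ≤ ∑ c : PBond P (j + 1), 260 * m c ^ 2 := Finset.sum_le_sum fun c _ => hpt c
    _ = 260 * ∑ c : PBond P (j + 1), m c ^ 2 := by rw [Finset.mul_sum]

/-! ## §2 ★★★ On the fibre: the true linearised iterate of any initial field in `ℓ¹` -/

/-- ★★★ **THE `Q`-JUNCTION IN `ℓ¹`: ON THE (0.4)-FIBRE THE TRUE LINEARISED ITERATE OF ANY INITIAL FIELD IS CONTROLLED BY ITS DISTANCE TO THE RATIO FIELD AND BY THE
ONE-STEP REMAINDERS.**  `U₀, W ∈ SU(N)` on the finest torus, `W̄^{(k)} = Ū₀^{(k)}` (the competitor lies on the (0.4)-fibre of `U₀`), `k ≤ m + K`; `Q` the true linearised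
iterate of ✓ p606268 (`hQ0`, `hQs`); `X` ANY initial bond field (the door: `X = I•D` at a chart point); tower loop sizes `dist1(W^{(j)}_i(c)) ≤ a j ≤ 1/24`, `0 ≤ a j < δ_N`;
DISPLAYED per-level walk masses `m j c` of the level ratios `Y_j = pertVar Ū₀^{(j)} W̄^{(j)}` along the (0.4) walks at `c` with `72·m ≤ 1`, `3m + a_j < δ_N`.  Then, with the
letters of file 1b (`ρ₁ = (L^d)⁻¹L`, `κ₁ = 159(d+2)L·2d`, `E_j = exp((κ₁∕ρ₁)Σ_{i<j}a_i)`), `g₀ = Σ_b‖pertVar U₀ W b − X b‖` and `S_j = Σ_{i<j}ρ₁^{j−1−i}·260·Σ_c m_i(c)²`: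
`Σ_c‖Q k X c‖ ≤ E_k·(ρ₁ᵏg₀ + S_k) + 2d·Σ_{j<k}(d+2)L·(E_j·(ρ₁ʲg₀ + S_j))`.
[cite: Balaban1985Averaging, Prop. 3 (122)-(126) p.36; Balaban1984PropagatorsI, (1.18)-(1.20) pp.19-20; Balaban1985Variational, Prop. 7 p.299] -/
theorem sum_norm_trueLinIter_le_of_iter_eq (U₀ W : GaugeField P 0 (Matrix.specialUnitaryGroup (Fin N) ℂ)) {k : ℕ} (hk : k ≤ P.m + P.K)
    (hfib : Averaging.iter (fun i => blockAvg (P := P) (j := i) (expMeanLogSU (n := Fin N))) k W = Averaging.iter (fun i => blockAvg (P := P) (j := i) (expMeanLogSU (n := Fin N))) k U₀)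
    (Q : (k : ℕ) → (PBond P 0 → Matrix (Fin N) (Fin N) ℂ) → PBond P k → Matrix (Fin N) (Fin N) ℂ) (hQ0 : ∀ Y, Q 0 Y = Y)
    (hQs : ∀ (k : ℕ) (Y : PBond P 0 → Matrix (Fin N) (Fin N) ℂ) (c : PBond P (k + 1)), Q (k + 1) Y c
      = (fderiv ℂ (eml : (Idx P → Matrix (Fin N) (Fin N) ℂ) → Matrix (Fin N) (Fin N) ℂ)
            (fun i => ((loopHol (Averaging.iter (fun i => blockAvg (P := P) (j := i) (expMeanLogSU (n := Fin N))) k U₀) c i : Matrix.specialUnitaryGroup (Fin N) ℂ) : Matrix (Fin N) (Fin N) ℂ))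
            (fun i => covWalkSum (Averaging.iter (fun i => blockAvg (P := P) (j := i) (expMeanLogSU (n := Fin N))) k U₀) (Q k Y) (walk (emb c.src) (loopWord P.L c.dir (off i.1) i.2.1 i.2.2))
              * ((loopHol (Averaging.iter (fun i => blockAvg (P := P) (j := i) (expMeanLogSU (n := Fin N))) k U₀) c i : Matrix.specialUnitaryGroup (Fin N) ℂ) : Matrix (Fin N) (Fin N) ℂ))
            * star ((corr (expMeanLogSU (n := Fin N)) (Averaging.iter (fun i => blockAvg (P := P) (j := i) (expMeanLogSU (n := Fin N))) k U₀) c : Matrix.specialUnitaryGroup (Fin N) ℂ) : Matrix (Fin N) (Fin N) ℂ)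
          + ((corr (expMeanLogSU (n := Fin N)) (Averaging.iter (fun i => blockAvg (P := P) (j := i) (expMeanLogSU (n := Fin N))) k U₀) c : Matrix.specialUnitaryGroup (Fin N) ℂ) : Matrix (Fin N) (Fin N) ℂ)
            * covWalkSum (Averaging.iter (fun i => blockAvg (P := P) (j := i) (expMeanLogSU (n := Fin N))) k U₀) (Q k Y) (walk (emb c.src) (List.replicate P.L (c.dir, true)))
            * star ((corr (expMeanLogSU (n := Fin N)) (Averaging.iter (fun i => blockAvg (P := P) (j := i) (expMeanLogSU (n := Fin N))) k U₀) c : Matrix.specialUnitaryGroup (Fin N) ℂ) : Matrix (Fin N) (Fin N) ℂ)))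
    (X : PBond P 0 → Matrix (Fin N) (Fin N) ℂ)
    (a : ℕ → ℝ) (ha0 : ∀ j, 0 ≤ a j)
    (hα : ∀ j < k, ∀ (c : PBond P (j + 1)) (i : Idx P), dist1 (loopHol (Averaging.iter (fun i => blockAvg (P := P) (j := i) (expMeanLogSU (n := Fin N))) j U₀) c i) ≤ a j)
    (ha24 : ∀ j < k, a j ≤ 1 / 24) (haN : ∀ j < k, a j < deltaSU (Fin N))
    (m : (j : ℕ) → PBond P (j + 1) → ℝ)
    (hmL : ∀ j < k, ∀ (c : PBond P (j + 1)) (i : Idx P), ((walk (emb c.src) (loopWord P.L c.dir (off i.1) i.2.1 i.2.2)).map fun s => ‖pertVar (Averaging.iter (fun i => blockAvg (P := P) (j := i) (expMeanLogSU (n := Fin N))) j U₀) (Averaging.iter (fun i => blockAvg (P := P) (j := i) (expMeanLogSU (n := Fin N))) j W) s.bond‖).sum ≤ m j c)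
    (hmS : ∀ j < k, ∀ c : PBond P (j + 1), ((walk (emb c.src) (List.replicate P.L (c.dir, true))).map fun s => ‖pertVar (Averaging.iter (fun i => blockAvg (P := P) (j := i) (expMeanLogSU (n := Fin N))) j U₀) (Averaging.iter (fun i => blockAvg (P := P) (j := i) (expMeanLogSU (n := Fin N))) j W) s.bond‖).sum ≤ m j c)
    (hm72 : ∀ j < k, ∀ c : PBond P (j + 1), 72 * m j c ≤ 1) (hmN : ∀ j < k, ∀ c : PBond P (j + 1), 3 * m j c + a j < deltaSU (Fin N)) :
    ∑ c : PBond P k, ‖Q k X c‖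
      ≤ Real.exp ((159 * (((P.d + 2) * P.L : ℕ) : ℝ) * (2 * P.d)) / (((P.L : ℝ) ^ P.d)⁻¹ * (P.L : ℝ)) * ∑ i ∈ Finset.range k, a i) * ((((P.L : ℝ) ^ P.d)⁻¹ * (P.L : ℝ)) ^ k * (∑ b : PBond P 0, ‖pertVar U₀ W b - X b‖) + (∑ i ∈ Finset.range k, (((P.L : ℝ) ^ P.d)⁻¹ * (P.L : ℝ)) ^ (k - 1 - i) * (260 * ∑ c : PBond P (i + 1), m i c ^ 2)))
        + 2 * P.d * ∑ j ∈ Finset.range k, (((P.d + 2) * P.L : ℕ) : ℝ)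
            * (Real.exp ((159 * (((P.d + 2) * P.L : ℕ) : ℝ) * (2 * P.d)) / (((P.L : ℝ) ^ P.d)⁻¹ * (P.L : ℝ)) * ∑ i ∈ Finset.range j, a i) * ((((P.L : ℝ) ^ P.d)⁻¹ * (P.L : ℝ)) ^ j * (∑ b : PBond P 0, ‖pertVar U₀ W b - X b‖) + (∑ i ∈ Finset.range j, (((P.L : ℝ) ^ P.d)⁻¹ * (P.L : ℝ)) ^ (j - 1 - i) * (260 * ∑ c : PBond P (i + 1), m i c ^ 2)))) := by
  -- the sourced family `D′_j = Y_j − Q_j X` and its drive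
  have hDs : ∀ (j : ℕ) (c : PBond P (j + 1)), (fun j => (pertVar (Averaging.iter (fun i => blockAvg (P := P) (j := i) (expMeanLogSU (n := Fin N))) j U₀) (Averaging.iter (fun i => blockAvg (P := P) (j := i) (expMeanLogSU (n := Fin N))) j W)) - Q j X) (j + 1) c
      = (fderiv ℂ (eml : (Idx P → Matrix (Fin N) (Fin N) ℂ) → Matrix (Fin N) (Fin N) ℂ)
            (fun i => ((loopHol (Averaging.iter (fun i => blockAvg (P := P) (j := i) (expMeanLogSU (n := Fin N))) j U₀) c i : Matrix.specialUnitaryGroup (Fin N) ℂ) : Matrix (Fin N) (Fin N) ℂ))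
            (fun i => covWalkSum (Averaging.iter (fun i => blockAvg (P := P) (j := i) (expMeanLogSU (n := Fin N))) j U₀) ((fun j => (pertVar (Averaging.iter (fun i => blockAvg (P := P) (j := i) (expMeanLogSU (n := Fin N))) j U₀) (Averaging.iter (fun i => blockAvg (P := P) (j := i) (expMeanLogSU (n := Fin N))) j W)) - Q j X) j) (walk (emb c.src) (loopWord P.L c.dir (off i.1) i.2.1 i.2.2))
              * ((loopHol (Averaging.iter (fun i => blockAvg (P := P) (j := i) (expMeanLogSU (n := Fin N))) j U₀) c i : Matrix.specialUnitaryGroup (Fin N) ℂ) : Matrix (Fin N) (Fin N) ℂ))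
            * star ((corr (expMeanLogSU (n := Fin N)) (Averaging.iter (fun i => blockAvg (P := P) (j := i) (expMeanLogSU (n := Fin N))) j U₀) c : Matrix.specialUnitaryGroup (Fin N) ℂ) : Matrix (Fin N) (Fin N) ℂ)
          + ((corr (expMeanLogSU (n := Fin N)) (Averaging.iter (fun i => blockAvg (P := P) (j := i) (expMeanLogSU (n := Fin N))) j U₀) c : Matrix.specialUnitaryGroup (Fin N) ℂ) : Matrix (Fin N) (Fin N) ℂ)
            * covWalkSum (Averaging.iter (fun i => blockAvg (P := P) (j := i) (expMeanLogSU (n := Fin N))) j U₀) ((fun j => (pertVar (Averaging.iter (fun i => blockAvg (P := P) (j := i) (expMeanLogSU (n := Fin N))) j U₀) (Averaging.iter (fun i => blockAvg (P := P) (j := i) (expMeanLogSU (n := Fin N))) j W)) - Q j X) j) (walk (emb c.src) (List.replicate P.L (c.dir, true)))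
            * star ((corr (expMeanLogSU (n := Fin N)) (Averaging.iter (fun i => blockAvg (P := P) (j := i) (expMeanLogSU (n := Fin N))) j U₀) c : Matrix.specialUnitaryGroup (Fin N) ℂ) : Matrix (Fin N) (Fin N) ℂ)) + (fun j c => ((pertVar (Averaging.iter (fun i => blockAvg (P := P) (j := i) (expMeanLogSU (n := Fin N))) (j + 1) U₀) (Averaging.iter (fun i => blockAvg (P := P) (j := i) (expMeanLogSU (n := Fin N))) (j + 1) W)) c - (fderiv ℂ (eml : (Idx P → Matrix (Fin N) (Fin N) ℂ) → Matrix (Fin N) (Fin N) ℂ)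
            (fun i => ((loopHol (Averaging.iter (fun i => blockAvg (P := P) (j := i) (expMeanLogSU (n := Fin N))) j U₀) c i : Matrix.specialUnitaryGroup (Fin N) ℂ) : Matrix (Fin N) (Fin N) ℂ))
            (fun i => covWalkSum (Averaging.iter (fun i => blockAvg (P := P) (j := i) (expMeanLogSU (n := Fin N))) j U₀) (pertVar (Averaging.iter (fun i => blockAvg (P := P) (j := i) (expMeanLogSU (n := Fin N))) j U₀) (Averaging.iter (fun i => blockAvg (P := P) (j := i) (expMeanLogSU (n := Fin N))) j W)) (walk (emb c.src) (loopWord P.L c.dir (off i.1) i.2.1 i.2.2))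
              * ((loopHol (Averaging.iter (fun i => blockAvg (P := P) (j := i) (expMeanLogSU (n := Fin N))) j U₀) c i : Matrix.specialUnitaryGroup (Fin N) ℂ) : Matrix (Fin N) (Fin N) ℂ))
            * star ((corr (expMeanLogSU (n := Fin N)) (Averaging.iter (fun i => blockAvg (P := P) (j := i) (expMeanLogSU (n := Fin N))) j U₀) c : Matrix.specialUnitaryGroup (Fin N) ℂ) : Matrix (Fin N) (Fin N) ℂ)
          + ((corr (expMeanLogSU (n := Fin N)) (Averaging.iter (fun i => blockAvg (P := P) (j := i) (expMeanLogSU (n := Fin N))) j U₀) c : Matrix.specialUnitaryGroup (Fin N) ℂ) : Matrix (Fin N) (Fin N) ℂ)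
            * covWalkSum (Averaging.iter (fun i => blockAvg (P := P) (j := i) (expMeanLogSU (n := Fin N))) j U₀) (pertVar (Averaging.iter (fun i => blockAvg (P := P) (j := i) (expMeanLogSU (n := Fin N))) j U₀) (Averaging.iter (fun i => blockAvg (P := P) (j := i) (expMeanLogSU (n := Fin N))) j W)) (walk (emb c.src) (List.replicate P.L (c.dir, true)))
            * star ((corr (expMeanLogSU (n := Fin N)) (Averaging.iter (fun i => blockAvg (P := P) (j := i) (expMeanLogSU (n := Fin N))) j U₀) c : Matrix.specialUnitaryGroup (Fin N) ℂ) : Matrix (Fin N) (Fin N) ℂ)))) j c := by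
    intro j c
    exact sub_sourced U₀ (fun j => (pertVar (Averaging.iter (fun i => blockAvg (P := P) (j := i) (expMeanLogSU (n := Fin N))) j U₀) (Averaging.iter (fun i => blockAvg (P := P) (j := i) (expMeanLogSU (n := Fin N))) j W))) (fun j => Q j X) (fun j c => ((pertVar (Averaging.iter (fun i => blockAvg (P := P) (j := i) (expMeanLogSU (n := Fin N))) (j + 1) U₀) (Averaging.iter (fun i => blockAvg (P := P) (j := i) (expMeanLogSU (n := Fin N))) (j + 1) W)) c - (fderiv ℂ (eml : (Idx P → Matrix (Fin N) (Fin N) ℂ) → Matrix (Fin N) (Fin N) ℂ)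
            (fun i => ((loopHol (Averaging.iter (fun i => blockAvg (P := P) (j := i) (expMeanLogSU (n := Fin N))) j U₀) c i : Matrix.specialUnitaryGroup (Fin N) ℂ) : Matrix (Fin N) (Fin N) ℂ))
            (fun i => covWalkSum (Averaging.iter (fun i => blockAvg (P := P) (j := i) (expMeanLogSU (n := Fin N))) j U₀) (pertVar (Averaging.iter (fun i => blockAvg (P := P) (j := i) (expMeanLogSU (n := Fin N))) j U₀) (Averaging.iter (fun i => blockAvg (P := P) (j := i) (expMeanLogSU (n := Fin N))) j W)) (walk (emb c.src) (loopWord P.L c.dir (off i.1) i.2.1 i.2.2))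
              * ((loopHol (Averaging.iter (fun i => blockAvg (P := P) (j := i) (expMeanLogSU (n := Fin N))) j U₀) c i : Matrix.specialUnitaryGroup (Fin N) ℂ) : Matrix (Fin N) (Fin N) ℂ))
            * star ((corr (expMeanLogSU (n := Fin N)) (Averaging.iter (fun i => blockAvg (P := P) (j := i) (expMeanLogSU (n := Fin N))) j U₀) c : Matrix.specialUnitaryGroup (Fin N) ℂ) : Matrix (Fin N) (Fin N) ℂ)
          + ((corr (expMeanLogSU (n := Fin N)) (Averaging.iter (fun i => blockAvg (P := P) (j := i) (expMeanLogSU (n := Fin N))) j U₀) c : Matrix.specialUnitaryGroup (Fin N) ℂ) : Matrix (Fin N) (Fin N) ℂ)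
            * covWalkSum (Averaging.iter (fun i => blockAvg (P := P) (j := i) (expMeanLogSU (n := Fin N))) j U₀) (pertVar (Averaging.iter (fun i => blockAvg (P := P) (j := i) (expMeanLogSU (n := Fin N))) j U₀) (Averaging.iter (fun i => blockAvg (P := P) (j := i) (expMeanLogSU (n := Fin N))) j W)) (walk (emb c.src) (List.replicate P.L (c.dir, true)))
            * star ((corr (expMeanLogSU (n := Fin N)) (Averaging.iter (fun i => blockAvg (P := P) (j := i) (expMeanLogSU (n := Fin N))) j U₀) c : Matrix.specialUnitaryGroup (Fin N) ℂ) : Matrix (Fin N) (Fin N) ℂ)))) (fun j c => by rw [add_sub_cancel]) (fun j c => hQs j _ c) j c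
  -- the recursion families
  obtain ⟨G, hG0, hGs⟩ := exists_sourced_reduced_family (n := Fin N) U₀ (fun b => pertVar U₀ W b - X b) (fun j c => ((pertVar (Averaging.iter (fun i => blockAvg (P := P) (j := i) (expMeanLogSU (n := Fin N))) (j + 1) U₀) (Averaging.iter (fun i => blockAvg (P := P) (j := i) (expMeanLogSU (n := Fin N))) (j + 1) W)) c - (fderiv ℂ (eml : (Idx P → Matrix (Fin N) (Fin N) ℂ) → Matrix (Fin N) (Fin N) ℂ)
            (fun i => ((loopHol (Averaging.iter (fun i => blockAvg (P := P) (j := i) (expMeanLogSU (n := Fin N))) j U₀) c i : Matrix.specialUnitaryGroup (Fin N) ℂ) : Matrix (Fin N) (Fin N) ℂ))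
            (fun i => covWalkSum (Averaging.iter (fun i => blockAvg (P := P) (j := i) (expMeanLogSU (n := Fin N))) j U₀) (pertVar (Averaging.iter (fun i => blockAvg (P := P) (j := i) (expMeanLogSU (n := Fin N))) j U₀) (Averaging.iter (fun i => blockAvg (P := P) (j := i) (expMeanLogSU (n := Fin N))) j W)) (walk (emb c.src) (loopWord P.L c.dir (off i.1) i.2.1 i.2.2))
              * ((loopHol (Averaging.iter (fun i => blockAvg (P := P) (j := i) (expMeanLogSU (n := Fin N))) j U₀) c i : Matrix.specialUnitaryGroup (Fin N) ℂ) : Matrix (Fin N) (Fin N) ℂ))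
            * star ((corr (expMeanLogSU (n := Fin N)) (Averaging.iter (fun i => blockAvg (P := P) (j := i) (expMeanLogSU (n := Fin N))) j U₀) c : Matrix.specialUnitaryGroup (Fin N) ℂ) : Matrix (Fin N) (Fin N) ℂ)
          + ((corr (expMeanLogSU (n := Fin N)) (Averaging.iter (fun i => blockAvg (P := P) (j := i) (expMeanLogSU (n := Fin N))) j U₀) c : Matrix.specialUnitaryGroup (Fin N) ℂ) : Matrix (Fin N) (Fin N) ℂ)
            * covWalkSum (Averaging.iter (fun i => blockAvg (P := P) (j := i) (expMeanLogSU (n := Fin N))) j U₀) (pertVar (Averaging.iter (fun i => blockAvg (P := P) (j := i) (expMeanLogSU (n := Fin N))) j U₀) (Averaging.iter (fun i => blockAvg (P := P) (j := i) (expMeanLogSU (n := Fin N))) j W)) (walk (emb c.src) (List.replicate P.L (c.dir, true)))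
            * star ((corr (expMeanLogSU (n := Fin N)) (Averaging.iter (fun i => blockAvg (P := P) (j := i) (expMeanLogSU (n := Fin N))) j U₀) c : Matrix.specialUnitaryGroup (Fin N) ℂ) : Matrix (Fin N) (Fin N) ℂ))))
  obtain ⟨Λ, hΛ0, hΛs⟩ := exists_coarseGauge_family U₀ G
  have hG0' : ∀ b, G 0 b = (fun j => (pertVar (Averaging.iter (fun i => blockAvg (P := P) (j := i) (expMeanLogSU (n := Fin N))) j U₀) (Averaging.iter (fun i => blockAvg (P := P) (j := i) (expMeanLogSU (n := Fin N))) j W)) - Q j X) 0 b := by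
    intro b
    rw [hG0]
    simp only [Pi.sub_apply, hQ0]
    rfl
  have hmain := sum_norm_sourced_le U₀ (fun j c => ((pertVar (Averaging.iter (fun i => blockAvg (P := P) (j := i) (expMeanLogSU (n := Fin N))) (j + 1) U₀) (Averaging.iter (fun i => blockAvg (P := P) (j := i) (expMeanLogSU (n := Fin N))) (j + 1) W)) c - (fderiv ℂ (eml : (Idx P → Matrix (Fin N) (Fin N) ℂ) → Matrix (Fin N) (Fin N) ℂ)
            (fun i => ((loopHol (Averaging.iter (fun i => blockAvg (P := P) (j := i) (expMeanLogSU (n := Fin N))) j U₀) c i : Matrix.specialUnitaryGroup (Fin N) ℂ) : Matrix (Fin N) (Fin N) ℂ))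
            (fun i => covWalkSum (Averaging.iter (fun i => blockAvg (P := P) (j := i) (expMeanLogSU (n := Fin N))) j U₀) (pertVar (Averaging.iter (fun i => blockAvg (P := P) (j := i) (expMeanLogSU (n := Fin N))) j U₀) (Averaging.iter (fun i => blockAvg (P := P) (j := i) (expMeanLogSU (n := Fin N))) j W)) (walk (emb c.src) (loopWord P.L c.dir (off i.1) i.2.1 i.2.2))
              * ((loopHol (Averaging.iter (fun i => blockAvg (P := P) (j := i) (expMeanLogSU (n := Fin N))) j U₀) c i : Matrix.specialUnitaryGroup (Fin N) ℂ) : Matrix (Fin N) (Fin N) ℂ))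
            * star ((corr (expMeanLogSU (n := Fin N)) (Averaging.iter (fun i => blockAvg (P := P) (j := i) (expMeanLogSU (n := Fin N))) j U₀) c : Matrix.specialUnitaryGroup (Fin N) ℂ) : Matrix (Fin N) (Fin N) ℂ)
          + ((corr (expMeanLogSU (n := Fin N)) (Averaging.iter (fun i => blockAvg (P := P) (j := i) (expMeanLogSU (n := Fin N))) j U₀) c : Matrix.specialUnitaryGroup (Fin N) ℂ) : Matrix (Fin N) (Fin N) ℂ)
            * covWalkSum (Averaging.iter (fun i => blockAvg (P := P) (j := i) (expMeanLogSU (n := Fin N))) j U₀) (pertVar (Averaging.iter (fun i => blockAvg (P := P) (j := i) (expMeanLogSU (n := Fin N))) j U₀) (Averaging.iter (fun i => blockAvg (P := P) (j := i) (expMeanLogSU (n := Fin N))) j W)) (walk (emb c.src) (List.replicate P.L (c.dir, true)))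
            * star ((corr (expMeanLogSU (n := Fin N)) (Averaging.iter (fun i => blockAvg (P := P) (j := i) (expMeanLogSU (n := Fin N))) j U₀) c : Matrix.specialUnitaryGroup (Fin N) ℂ) : Matrix (Fin N) (Fin N) ℂ)))) (fun j => (pertVar (Averaging.iter (fun i => blockAvg (P := P) (j := i) (expMeanLogSU (n := Fin N))) j U₀) (Averaging.iter (fun i => blockAvg (P := P) (j := i) (expMeanLogSU (n := Fin N))) j W)) - Q j X) hDs G hG0' hGs Λ hΛ0 hΛs a ha0 hk hα ha24 haN
  -- on the fibre `Y_k = 0`, so `D′_k = −Q_k X`; and `D′_0 = Y − X`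
  have hfibre : ∀ c : PBond P k, ‖(fun j => (pertVar (Averaging.iter (fun i => blockAvg (P := P) (j := i) (expMeanLogSU (n := Fin N))) j U₀) (Averaging.iter (fun i => blockAvg (P := P) (j := i) (expMeanLogSU (n := Fin N))) j W)) - Q j X) k c‖ = ‖Q k X c‖ := by
    intro c
    simp only [Pi.sub_apply]
    rw [hfib, pertVar_self, zero_sub, norm_neg]
  have hD0 : ∑ b : PBond P 0, ‖(fun j => (pertVar (Averaging.iter (fun i => blockAvg (P := P) (j := i) (expMeanLogSU (n := Fin N))) j U₀) (Averaging.iter (fun i => blockAvg (P := P) (j := i) (expMeanLogSU (n := Fin N))) j W)) - Q j X) 0 b‖ = (∑ b : PBond P 0, ‖pertVar U₀ W b - X b‖) := by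
    refine Finset.sum_congr rfl fun b _ => ?_
    simp only [Pi.sub_apply, hQ0]
    rfl
  simp only [hfibre, hD0] at hmain
  -- the remainders through ★p1's one-step bound (monotonicity of the right-hand side)
  have hLpos : (0 : ℝ) < (P.L : ℝ) := by exact_mod_cast P.L_pos
  have hρ0 : (0 : ℝ) ≤ (((P.L : ℝ) ^ P.d)⁻¹ * (P.L : ℝ)) := by positivity
  have hR : ∀ l < k, ∑ c : PBond P (l + 1), ‖((pertVar (Averaging.iter (fun i => blockAvg (P := P) (j := i) (expMeanLogSU (n := Fin N))) (l + 1) U₀) (Averaging.iter (fun i => blockAvg (P := P) (j := i) (expMeanLogSU (n := Fin N))) (l + 1) W)) c - (fderiv ℂ (eml : (Idx P → Matrix (Fin N) (Fin N) ℂ) → Matrix (Fin N) (Fin N) ℂ)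
            (fun i => ((loopHol (Averaging.iter (fun i => blockAvg (P := P) (j := i) (expMeanLogSU (n := Fin N))) l U₀) c i : Matrix.specialUnitaryGroup (Fin N) ℂ) : Matrix (Fin N) (Fin N) ℂ))
            (fun i => covWalkSum (Averaging.iter (fun i => blockAvg (P := P) (j := i) (expMeanLogSU (n := Fin N))) l U₀) (pertVar (Averaging.iter (fun i => blockAvg (P := P) (j := i) (expMeanLogSU (n := Fin N))) l U₀) (Averaging.iter (fun i => blockAvg (P := P) (j := i) (expMeanLogSU (n := Fin N))) l W)) (walk (emb c.src) (loopWord P.L c.dir (off i.1) i.2.1 i.2.2))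
              * ((loopHol (Averaging.iter (fun i => blockAvg (P := P) (j := i) (expMeanLogSU (n := Fin N))) l U₀) c i : Matrix.specialUnitaryGroup (Fin N) ℂ) : Matrix (Fin N) (Fin N) ℂ))
            * star ((corr (expMeanLogSU (n := Fin N)) (Averaging.iter (fun i => blockAvg (P := P) (j := i) (expMeanLogSU (n := Fin N))) l U₀) c : Matrix.specialUnitaryGroup (Fin N) ℂ) : Matrix (Fin N) (Fin N) ℂ)
          + ((corr (expMeanLogSU (n := Fin N)) (Averaging.iter (fun i => blockAvg (P := P) (j := i) (expMeanLogSU (n := Fin N))) l U₀) c : Matrix.specialUnitaryGroup (Fin N) ℂ) : Matrix (Fin N) (Fin N) ℂ)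
            * covWalkSum (Averaging.iter (fun i => blockAvg (P := P) (j := i) (expMeanLogSU (n := Fin N))) l U₀) (pertVar (Averaging.iter (fun i => blockAvg (P := P) (j := i) (expMeanLogSU (n := Fin N))) l U₀) (Averaging.iter (fun i => blockAvg (P := P) (j := i) (expMeanLogSU (n := Fin N))) l W)) (walk (emb c.src) (List.replicate P.L (c.dir, true)))
            * star ((corr (expMeanLogSU (n := Fin N)) (Averaging.iter (fun i => blockAvg (P := P) (j := i) (expMeanLogSU (n := Fin N))) l U₀) c : Matrix.specialUnitaryGroup (Fin N) ℂ) : Matrix (Fin N) (Fin N) ℂ)))‖ ≤ 260 * ∑ c : PBond P (l + 1), m l c ^ 2 :=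
    fun l hl => sum_norm_oneStep_remainder_le U₀ W l (m l) (hmL l hl) (hmS l hl) (hm72 l hl) (hα l hl) (ha24 l hl) (hmN l hl)
  have hS : ∀ j ≤ k, (∑ l ∈ Finset.range j, (((P.L : ℝ) ^ P.d)⁻¹ * (P.L : ℝ)) ^ (j - 1 - l) * ∑ c : PBond P (l + 1), ‖((pertVar (Averaging.iter (fun i => blockAvg (P := P) (j := i) (expMeanLogSU (n := Fin N))) (l + 1) U₀) (Averaging.iter (fun i => blockAvg (P := P) (j := i) (expMeanLogSU (n := Fin N))) (l + 1) W)) c - (fderiv ℂ (eml : (Idx P → Matrix (Fin N) (Fin N) ℂ) → Matrix (Fin N) (Fin N) ℂ)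
            (fun i => ((loopHol (Averaging.iter (fun i => blockAvg (P := P) (j := i) (expMeanLogSU (n := Fin N))) l U₀) c i : Matrix.specialUnitaryGroup (Fin N) ℂ) : Matrix (Fin N) (Fin N) ℂ))
            (fun i => covWalkSum (Averaging.iter (fun i => blockAvg (P := P) (j := i) (expMeanLogSU (n := Fin N))) l U₀) (pertVar (Averaging.iter (fun i => blockAvg (P := P) (j := i) (expMeanLogSU (n := Fin N))) l U₀) (Averaging.iter (fun i => blockAvg (P := P) (j := i) (expMeanLogSU (n := Fin N))) l W)) (walk (emb c.src) (loopWord P.L c.dir (off i.1) i.2.1 i.2.2))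
              * ((loopHol (Averaging.iter (fun i => blockAvg (P := P) (j := i) (expMeanLogSU (n := Fin N))) l U₀) c i : Matrix.specialUnitaryGroup (Fin N) ℂ) : Matrix (Fin N) (Fin N) ℂ))
            * star ((corr (expMeanLogSU (n := Fin N)) (Averaging.iter (fun i => blockAvg (P := P) (j := i) (expMeanLogSU (n := Fin N))) l U₀) c : Matrix.specialUnitaryGroup (Fin N) ℂ) : Matrix (Fin N) (Fin N) ℂ)
          + ((corr (expMeanLogSU (n := Fin N)) (Averaging.iter (fun i => blockAvg (P := P) (j := i) (expMeanLogSU (n := Fin N))) l U₀) c : Matrix.specialUnitaryGroup (Fin N) ℂ) : Matrix (Fin N) (Fin N) ℂ)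
            * covWalkSum (Averaging.iter (fun i => blockAvg (P := P) (j := i) (expMeanLogSU (n := Fin N))) l U₀) (pertVar (Averaging.iter (fun i => blockAvg (P := P) (j := i) (expMeanLogSU (n := Fin N))) l U₀) (Averaging.iter (fun i => blockAvg (P := P) (j := i) (expMeanLogSU (n := Fin N))) l W)) (walk (emb c.src) (List.replicate P.L (c.dir, true)))
            * star ((corr (expMeanLogSU (n := Fin N)) (Averaging.iter (fun i => blockAvg (P := P) (j := i) (expMeanLogSU (n := Fin N))) l U₀) c : Matrix.specialUnitaryGroup (Fin N) ℂ) : Matrix (Fin N) (Fin N) ℂ)))‖) ≤ (∑ i ∈ Finset.range j, (((P.L : ℝ) ^ P.d)⁻¹ * (P.L : ℝ)) ^ (j - 1 - i) * (260 * ∑ c : PBond P (i + 1), m i c ^ 2)) := by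
    intro j hj
    refine Finset.sum_le_sum fun l hl => ?_
    have hlk : l < k := (Finset.mem_range.mp hl).trans_le hj
    exact mul_le_mul_of_nonneg_left (hR l hlk) (pow_nonneg hρ0 _)
  have hE0 : ∀ j, 0 ≤ Real.exp ((159 * (((P.d + 2) * P.L : ℕ) : ℝ) * (2 * P.d)) / (((P.L : ℝ) ^ P.d)⁻¹ * (P.L : ℝ)) * ∑ i ∈ Finset.range j, a i) := fun j => (Real.exp_pos _).le
  have hC0 : (0 : ℝ) ≤ (((P.d + 2) * P.L : ℕ) : ℝ) := Nat.cast_nonneg _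
  refine hmain.trans (add_le_add (mul_le_mul_of_nonneg_left (add_le_add le_rfl (hS k le_rfl)) (hE0 k)) ?_)
  refine mul_le_mul_of_nonneg_left (Finset.sum_le_sum fun j hj => ?_) (by positivity)
  exact mul_le_mul_of_nonneg_left (mul_le_mul_of_nonneg_left (add_le_add le_rfl (hS j (Finset.mem_range.mp hj).le)) (hE0 j)) hC0

/-- ★★★ **THE SAME, k-UNIFORM CONSTANTS** (`2 ≤ d`): under the hypotheses of `sum_norm_trueLinIter_le_of_iter_eq`,
`Σ_c‖Q k X c‖ ≤ (1 + 4d(d+2)L)·exp((κ₁∕ρ₁)Σ_{j<k}a_j)·(Σ_b‖pertVar U₀ W b − X b‖ + Σ_{j<k} 260·Σ_c m_j(c)²)` — NO power of the number of levels and no volume: on the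
fibre the `ℓ¹` size of the true linearised iterate of `X` is the `ℓ¹` distance of `X` to the ratio field plus the summed one-step remainders, times `(1 + 60L)·E_k` at d = 3.
[cite: Balaban1985Averaging, Prop. 3 (122)-(126) p.36; Balaban1984PropagatorsI, (1.18)-(1.20) pp.19-20; Balaban1985Variational, Prop. 7 p.299] -/
theorem sum_norm_trueLinIter_le_of_iter_eq_uniform (hd2 : 2 ≤ P.d) (U₀ W : GaugeField P 0 (Matrix.specialUnitaryGroup (Fin N) ℂ)) {k : ℕ} (hk : k ≤ P.m + P.K)
    (hfib : Averaging.iter (fun i => blockAvg (P := P) (j := i) (expMeanLogSU (n := Fin N))) k W = Averaging.iter (fun i => blockAvg (P := P) (j := i) (expMeanLogSU (n := Fin N))) k U₀)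
    (Q : (k : ℕ) → (PBond P 0 → Matrix (Fin N) (Fin N) ℂ) → PBond P k → Matrix (Fin N) (Fin N) ℂ) (hQ0 : ∀ Y, Q 0 Y = Y)
    (hQs : ∀ (k : ℕ) (Y : PBond P 0 → Matrix (Fin N) (Fin N) ℂ) (c : PBond P (k + 1)), Q (k + 1) Y c
      = (fderiv ℂ (eml : (Idx P → Matrix (Fin N) (Fin N) ℂ) → Matrix (Fin N) (Fin N) ℂ)
            (fun i => ((loopHol (Averaging.iter (fun i => blockAvg (P := P) (j := i) (expMeanLogSU (n := Fin N))) k U₀) c i : Matrix.specialUnitaryGroup (Fin N) ℂ) : Matrix (Fin N) (Fin N) ℂ))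
            (fun i => covWalkSum (Averaging.iter (fun i => blockAvg (P := P) (j := i) (expMeanLogSU (n := Fin N))) k U₀) (Q k Y) (walk (emb c.src) (loopWord P.L c.dir (off i.1) i.2.1 i.2.2))
              * ((loopHol (Averaging.iter (fun i => blockAvg (P := P) (j := i) (expMeanLogSU (n := Fin N))) k U₀) c i : Matrix.specialUnitaryGroup (Fin N) ℂ) : Matrix (Fin N) (Fin N) ℂ))
            * star ((corr (expMeanLogSU (n := Fin N)) (Averaging.iter (fun i => blockAvg (P := P) (j := i) (expMeanLogSU (n := Fin N))) k U₀) c : Matrix.specialUnitaryGroup (Fin N) ℂ) : Matrix (Fin N) (Fin N) ℂ)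
          + ((corr (expMeanLogSU (n := Fin N)) (Averaging.iter (fun i => blockAvg (P := P) (j := i) (expMeanLogSU (n := Fin N))) k U₀) c : Matrix.specialUnitaryGroup (Fin N) ℂ) : Matrix (Fin N) (Fin N) ℂ)
            * covWalkSum (Averaging.iter (fun i => blockAvg (P := P) (j := i) (expMeanLogSU (n := Fin N))) k U₀) (Q k Y) (walk (emb c.src) (List.replicate P.L (c.dir, true)))
            * star ((corr (expMeanLogSU (n := Fin N)) (Averaging.iter (fun i => blockAvg (P := P) (j := i) (expMeanLogSU (n := Fin N))) k U₀) c : Matrix.specialUnitaryGroup (Fin N) ℂ) : Matrix (Fin N) (Fin N) ℂ)))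
    (X : PBond P 0 → Matrix (Fin N) (Fin N) ℂ)
    (a : ℕ → ℝ) (ha0 : ∀ j, 0 ≤ a j)
    (hα : ∀ j < k, ∀ (c : PBond P (j + 1)) (i : Idx P), dist1 (loopHol (Averaging.iter (fun i => blockAvg (P := P) (j := i) (expMeanLogSU (n := Fin N))) j U₀) c i) ≤ a j)
    (ha24 : ∀ j < k, a j ≤ 1 / 24) (haN : ∀ j < k, a j < deltaSU (Fin N))
    (m : (j : ℕ) → PBond P (j + 1) → ℝ)
    (hmL : ∀ j < k, ∀ (c : PBond P (j + 1)) (i : Idx P), ((walk (emb c.src) (loopWord P.L c.dir (off i.1) i.2.1 i.2.2)).map fun s => ‖pertVar (Averaging.iter (fun i => blockAvg (P := P) (j := i) (expMeanLogSU (n := Fin N))) j U₀) (Averaging.iter (fun i => blockAvg (P := P) (j := i) (expMeanLogSU (n := Fin N))) j W) s.bond‖).sum ≤ m j c)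
    (hmS : ∀ j < k, ∀ c : PBond P (j + 1), ((walk (emb c.src) (List.replicate P.L (c.dir, true))).map fun s => ‖pertVar (Averaging.iter (fun i => blockAvg (P := P) (j := i) (expMeanLogSU (n := Fin N))) j U₀) (Averaging.iter (fun i => blockAvg (P := P) (j := i) (expMeanLogSU (n := Fin N))) j W) s.bond‖).sum ≤ m j c)
    (hm72 : ∀ j < k, ∀ c : PBond P (j + 1), 72 * m j c ≤ 1) (hmN : ∀ j < k, ∀ c : PBond P (j + 1), 3 * m j c + a j < deltaSU (Fin N)) :
    ∑ c : PBond P k, ‖Q k X c‖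
      ≤ (1 + 4 * P.d * (((P.d + 2) * P.L : ℕ) : ℝ)) * Real.exp ((159 * (((P.d + 2) * P.L : ℕ) : ℝ) * (2 * P.d)) / (((P.L : ℝ) ^ P.d)⁻¹ * (P.L : ℝ)) * ∑ i ∈ Finset.range k, a i)
          * ((∑ b : PBond P 0, ‖pertVar U₀ W b - X b‖) + ∑ j ∈ Finset.range k, 260 * ∑ c : PBond P (j + 1), m j c ^ 2) := by
  have h := sum_norm_trueLinIter_le_of_iter_eq U₀ W hk hfib Q hQ0 hQs X a ha0 hα ha24 haN m hmL hmS hm72 hmN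
  have hLpos : (0 : ℝ) < (P.L : ℝ) := by exact_mod_cast P.L_pos
  have hL2 : (2 : ℝ) ≤ (P.L : ℝ) := by exact_mod_cast P.hL.2
  have hLdpos : (0 : ℝ) < (P.L : ℝ) ^ P.d := by positivity
  have hρ0 : (0 : ℝ) ≤ (((P.L : ℝ) ^ P.d)⁻¹ * (P.L : ℝ)) := by positivity
  have hρhalf : (((P.L : ℝ) ^ P.d)⁻¹ * (P.L : ℝ)) ≤ 1 / 2 := by
    have hLd : (P.L : ℝ) * P.L ≤ (P.L : ℝ) ^ P.d := by
      calc (P.L : ℝ) * P.L = (P.L : ℝ) ^ 2 := by ring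
        _ ≤ (P.L : ℝ) ^ P.d := pow_le_pow_right₀ (by linarith) hd2
    rw [← div_eq_inv_mul, div_le_iff₀ hLdpos]
    nlinarith
  have hκρ : (0 : ℝ) ≤ (159 * (((P.d + 2) * P.L : ℕ) : ℝ) * (2 * P.d)) / (((P.L : ℝ) ^ P.d)⁻¹ * (P.L : ℝ)) := by positivity
  have hE0 : ∀ j, 0 ≤ (fun j => Real.exp ((159 * (((P.d + 2) * P.L : ℕ) : ℝ) * (2 * P.d)) / (((P.L : ℝ) ^ P.d)⁻¹ * (P.L : ℝ)) * ∑ i ∈ Finset.range j, a i)) j := fun j => Real.exp_nonneg _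
  have hEmono : ∀ j k, j ≤ k → (fun j => Real.exp ((159 * (((P.d + 2) * P.L : ℕ) : ℝ) * (2 * P.d)) / (((P.L : ℝ) ^ P.d)⁻¹ * (P.L : ℝ)) * ∑ i ∈ Finset.range j, a i)) j ≤ (fun j => Real.exp ((159 * (((P.d + 2) * P.L : ℕ) : ℝ) * (2 * P.d)) / (((P.L : ℝ) ^ P.d)⁻¹ * (P.L : ℝ)) * ∑ i ∈ Finset.range j, a i)) k := fun j k hjk =>
    Real.exp_le_exp.2 (mul_le_mul_of_nonneg_left
      (Finset.sum_le_sum_of_subset_of_nonneg (Finset.range_mono hjk) (fun i _ _ => ha0 i)) hκρ)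
  have hC : (0 : ℝ) ≤ (((P.d + 2) * P.L : ℕ) : ℝ) := Nat.cast_nonneg _
  have hT : (0 : ℝ) ≤ 2 * P.d := by positivity
  have hg0 : 0 ≤ (∑ b : PBond P 0, ‖pertVar U₀ W b - X b‖) := Finset.sum_nonneg fun b _ => norm_nonneg _
  have hm0 : ∀ j, 0 ≤ 260 * ∑ c : PBond P (j + 1), m j c ^ 2 := fun j => mul_nonneg (by norm_num) (Finset.sum_nonneg fun c _ => sq_nonneg _)
  have hmain := geom_weights_uniform hρ0 hρhalf (fun j => Real.exp ((159 * (((P.d + 2) * P.L : ℕ) : ℝ) * (2 * P.d)) / (((P.L : ℝ) ^ P.d)⁻¹ * (P.L : ℝ)) * ∑ i ∈ Finset.range j, a i)) hE0 hEmono hC hT (∑ b : PBond P 0, ‖pertVar U₀ W b - X b‖) hg0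
    (fun j => 260 * ∑ c : PBond P (j + 1), m j c ^ 2) hm0 k
  calc _ ≤ _ := h
    _ ≤ (1 + 2 * (2 * (P.d : ℝ)) * (((P.d + 2) * P.L : ℕ) : ℝ)) * Real.exp ((159 * (((P.d + 2) * P.L : ℕ) : ℝ) * (2 * P.d)) / (((P.L : ℝ) ^ P.d)⁻¹ * (P.L : ℝ)) * ∑ i ∈ Finset.range k, a i)
          * ((∑ b : PBond P 0, ‖pertVar U₀ W b - X b‖) + ∑ j ∈ Finset.range k, 260 * ∑ c : PBond P (j + 1), m j c ^ 2) := hmain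
    _ = _ := by ring

end Summit.QuantumFields.YangMills.Theorems.Prop7FibreTrueLinDefectL1

end
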